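import Mathlib
import Literature.NumberTheory.LFunctions.RiemannXi

/-!
# Connes' prolate guess `k_λ` and Fact 6.4 of the *Letter* (Connes 2026)

This file TYPES the statement of Fact 6.4 of A. Connes, *The Riemann Hypothesis:
past, present and a letter through time* (arXiv:2602.04022, §6.5), which is Lemma 7.3 of
Connes–Consani–Moscovici, *Zeta spectral triples* (arXiv:2511.22755, §7; published in *Applications of
Noncommutative Geometry to Gauge Theories, Field Theories, and Quantum Space-Time*, EMS Ser. Lect. Math. 37,
EMS Press 2026, pp. 39–76, doi:10.4171/elm/37/3 [cite: ConnesConsaniMoscovici2026]), as the `Prop`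
`prolateGuess_tendsto_riemannXi`, in Mellin form and with the tree's `riemannXi`; the statement is PROVED
in the tree, unconditionally, in the sibling files listed under *Status* below.  It is NOT a statement
about the Riemann hypothesis: it compares the *prolate guess* `k_λ` (an explicit function built from two
prolate spheroidal wave functions) with Riemann's `ξ`, and its proof in print uses only Sturm–Liouville /
prolate asymptotics (Meixner–Schäfke 1954, §3.2 Satz 9), Poisson summation and Müntz's formula.

## The objects (Letter §6.1–6.4; CCM25 §7, (7.1)–(7.12))

* `connesE f u = u^{1/2} Σ_{n ≥ 1} f(n u)` — the summation map `𝓔` (Letter (6.1), CCM25 (7.2)).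
* `IsProlateFunction lam n f` — `f` is the prolate spheroidal wave function `h_{n,λ}` of the prolate wave
  operator `PW_λ = −∂(λ² − x²)∂ + (2πλx)²` on `[−λ, λ]` (Letter (6.3), CCM25 (7.5)), characterised WITHOUT
  an eigenvalue ordering, by Sturm oscillation: a `C²`-up-to-the-boundary (= principal at both
  regular-singular endpoints) eigenfunction with exactly `n` zeros in `(−λ, λ)`, extended by `0` outside
  `[−λ, λ]`, `L²`-normalised and positive at `0` (the normalisation (7.10)–(7.12) of CCM25:
  `h_{n,λ}(x) = λ^{-1/2} ψ_n(c, x/λ)`, `c = 2πλ²`, `ψ_n` the unit-norm PSWF on `[−1,1]`); for even `n` it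
  is an even function.  Existence and uniqueness for even `n` is the separate statement
  `existsUnique_isProlateFunction` (Slepian–Pollak; CCM25 §7) — kept separate so that nothing is smuggled
  into the interface; it is proved in the tree (`existsUnique_isProlateFunction_holds`, file
  `ProlateExistsUnique.lean`).
* `prolateGuessH lam f0 f4` — the Letter's `h_λ`: the linear combination of `h_{4,λ}, h_{0,λ}` with
  vanishing integral, normalised so that the coefficient of `h_{4,λ}` equals the coefficient `√3 / 2^{11/4}`
  of `h_4` in `h = (√3/2^{11/4}) h_4 − (3/2^{17/4}) h_0` (CCM25 Lemma 7.1, (7.4)).  The Letter fixes `h_λ`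
  only "up to a multiplicative scalar"; any normalisation with coefficients → those of `h` gives the same
  limit statement.
* `prolateGuessMellin lam f0 f4 s = ∫_{1/λ}^{λ} 𝓔(h_λ)(u) u^{s-1} du` — the Mellin transform of
  `k_λ := 𝓔(h_λ)|_{[λ^{-1}, λ]}` (Letter (6.6)); in the Letter's multiplicative Fourier variable `z`,
  `s = −iz`, and "closed substrips of `|Im z| < 1/2`" are `|Re s| ≤ α₀ < 1/2`.
* Normalisation of `ξ`: `4 ∫_0^∞ 𝓔(h)(u) u^{s-1} du = ξ(1/2 + s)` for `|Re s| < 1/2` (Müntz's formula and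
  CCM25 Lemma 7.1: `4 ζ(w) ∫_0^∞ h(x) x^{w-1} dx = ξ(w)`); the Letter's "`k̂ = Ξ`" absorbs the factor `4`.

## Status and what is deliberately NOT here

`prolateGuess_tendsto_riemannXi` is PROVED IN PRINT (CCM25 Lemma 7.3, from Lemma 7.2(i) = Meixner–Schäfke's
uniform Hermite asymptotics of `ps_n(z; γ²)`), unconditionally (no RH), with the rate
`c · λ^{-1/2-α}(1 − 2α)^{-1}` on `Re s = α`, and it is PROVED IN THE TREE, unconditionally and RH-free:
`prolateGuess_tendsto_riemannXi_rhFree` (file `ConnesProlateGuessRHFree.lean`: qualitative prolate →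
Hermite limits from eigenvalue pinning and a Gronwall window comparison, `ConnesProlateGuessSturm.lean`,
`ConnesProlateGuessWindow.lean`); a second proof goes through the `λ^{-2}` sup-norm prolate → Hermite rate
(`ProlateSupNormRate.lean`, reduction `ConnesProlateGuessFact.lean`), which also gives the printed rate
`O(λ^{-1/2-Re s})` as `prolateGuess_rate` (file `ConnesProlateGuessRate.lean`) and the rate `O(λ^{-2})`,
uniformly on every closed substrip `|Re s| ≤ α₀ < 1/2`, as `prolateGuess_rate_sharp` (file
`ConnesProlateGuessRateSharp.lean`; inexplicit constant).  This file only types the statement; a user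
may still take the explicit hypothesis
`(h : prolateGuess_tendsto_riemannXi)` and discharge it with `prolateGuess_tendsto_riemannXi_rhFree`.
The statement was tested numerically (double precision,
40-digit `mpmath`, `Arb` balls; connes-x13 bundle, `RATE.md`) at `λ² ∈ {5, 8, 13, 20}` and up to `λ² = 50`
on `|Im s| ≤ 60`, `Re s ∈ {0, ±1/4, ±0.4}`: the observed error is `≈ 0.12 · λ^{-2}`, uniformly in `α` and
symmetric under `α ↦ −α` — much smaller than the printed bound.  That sharper rate is PROVED ON PAPER in the
bundle (`paper/P1STAR-PROOF.md`, Theorems 2′, 4, 5, 6, 7 and (5.2): for `λ² ≥ 13` and all `t ∈ ℝ`,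
`‖4 · M_λ(it) − ξ(1/2 + it)‖ ≤ 12.5 · λ^{-2}`, and `≤ 27 · λ^{-2} + 10^{-12}`, `≤ 63 · λ^{-2} + 10^{-12}` on
`|Re s| ≤ 1/4`, `|Re s| ≤ 0.4`, and on the whole open strip
`‖4 · M_λ(s) − ξ(1/2 + s)‖ ≤ (1/4 − (Re s)²)^{-1} · (6.07 · λ^{-2} + 10^{-13})` for every `|Re s| < 1/2` — so the
rate `λ^{-2}` holds with an explicit constant on EVERY closed substrip `|Re s| ≤ α₀ < 1/2`, the full range of
Fact 6.4 — and, uniformly in `|Re s| < 1/2` on `|Im s| ≤ 1`, `‖4 · M_λ(s) − ξ(1/2 + s)‖ ≤ 4.0 · λ^{-2} + 10^{-13}` with no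
factor `(1/4 − (Re s)²)^{-1}` (Theorem 7; second order `45.4 · λ^{-4} + 10^{-13}`), and finally, UNIFORMLY ON THE
WHOLE OPEN STRIP FOR ALL `t` WITH NO ADDITIVE CONSTANT, `‖4 · M_λ(s) − ξ(1/2 + s)‖ ≤ 18.3 · λ^{-2}` and
`‖4 · M_λ(s) − ξ(1/2 + s) − 4 λ^{-2} ζ(1/2 + s) φ̃(1/2 + s)‖ ≤ 171 · λ^{-4}` for every `|Re s| < 1/2`, every `t = Im s` and
every `λ² ≥ 13` (Theorem 8: the half-strip `Re s ≥ 0` by the first route, the half-strip `Re s < 0` by the QUANTITATIVE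
EVENNESS `‖4 · M_λ(s) − 4 · M_λ(−s)‖ ≤ 1.3 · 10^{-18}`, Proposition D′, which comes from Poisson duality at every step and
the exponentially small inversion defect `u^{1/2}|k_λ(1/u) − k_λ(u)| ≤ 4.3 · 10^{-20}` of the prolate guess; the additive
decimals are absorbed by monotonicity in `λ`), so that `λ² · (4 · M_λ(s) − ξ(1/2 + s)) → 4 ζ(1/2 + s) φ̃(1/2 + s)`
uniformly on the open strip `|Re s| < 1/2` itself
(`φ̃` the Mellin transform of an explicit Hermite-type Schwartz function `φ` with `∫ φ = φ(0) = 0`; the limit profile is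
continuous on the closed strip and symmetric under `s ↦ −s`); `λ² · sup_t ‖4 · M_λ(it) − ξ(1/2 + it)‖ → c_♯ = 0.116607…` and
`λ² · sup_{|Re s| < 1/2} ‖4 · M_λ(s) − ξ(1/2 + s)‖ → c_♭ = sup_t |4 ζ(1 + it) φ̃(1 + it)| = 0.1186708…` (maximum principle on the
closed strip, the pole of `ζ` at `1` being cancelled by `φ̃(1) = ∫ φ = 0`; both constants interval-certified by two independent
implementations — `c_♯ ∈ [0.1166073980, 0.1166074080]`, `c_♭ ∈ [0.1186708667, 0.1186708767]`, maximisers `t = 7.06`, `7.03`), with an explicit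
`O(λ^{-4})` remainder — RH-free, from the Friedrichs form of the prolate operator, Hermite algebra, Poisson summation and
one Mellin integration by parts, with no numerically evaluated value of `ζ`; self-checked and refereed by independent seats of
the bundle (Theorem 8 by the generation-12 seat, every constant recomputed in outward-rounded interval arithmetic), but
neither peer-reviewed nor formalised with these constants — the tree theorem `prolateGuess_rate_sharp`
is the `O(λ^{-2})` law with an inexplicit constant).  Being the bundle's own result and not literature,
the explicit-constant form is deliberately NOT stated in this file (the bundle's standalone package
`lean/ConnesX13` types it as the `Prop`s
`ConnesX13.prolateGuess_rate_uniform`, `ConnesX13.prolateGuess_secondOrder_uniform`, `ConnesX13.prolateGuess_rate_openStrip`,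
`ConnesX13.prolateGuess_rate_openStrip_uniform`, `ConnesX13.prolateGuess_evenness_defect` and `ConnesX13.prolateGuess_rate_openStrip_total`,
the last with the kernel-checked corollary `ConnesX13.prolateGuess_rate_openStrip_total.tendsto`, whose conclusion is
`prolateGuess_tendsto_riemannXi` exactly as typed below).  Nothing about the Weil
quadratic form, its ground state `θ_λ`, or RH is here.
-/

noncomputable section

open Real MeasureTheory Complex

namespace Literature.NumberTheory.LFunctions

/-- Connes' summation map `𝓔(f)(u) = u^{1/2} Σ_{n ≥ 1} f(n u)`, `u > 0` (Connes 2026, Letter §6.1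
eq. (6.1); Connes–Consani–Moscovici 2025, (7.2)).  For the compactly supported `f` used below the series is
a finite sum; for a non-summable `f` Mathlib's `tsum` junk value `0` is irrelevant to the statements here.
[cite: Connes2026Letter, §6.1 eq. (6.1)] -/
def connesE (f : ℝ → ℝ) (u : ℝ) : ℝ :=
  Real.sqrt u * ∑' n : ℕ, f ((n + 1 : ℕ) * u)

/-- `IsProlateFunction lam n f`: `f : ℝ → ℝ` is the prolate spheroidal wave function `h_{n,λ}` of
`PW_λ = −∂(λ² − x²)∂ + (2πλx)²` (Connes 2026, Letter (6.3); Connes–Consani–Moscovici 2025, (7.5)) in the normalisation of CCM25 (7.10)–(7.12):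
`λ > 0`; `f` is `C²` on the closed interval `[−λ, λ]` (this selects the principal = bounded solution at the
regular singular endpoints `±λ`), satisfies the eigen-equation on `(−λ, λ)` for some eigenvalue `χ`, vanishes
outside `[−λ, λ]`, has exactly `n` zeros in `(−λ, λ)` (Sturm oscillation: this says `χ = χ_n(2πλ²)` without
ordering eigenvalues), has `∫_{−λ}^{λ} f² = 1` and `f(0) > 0` (for even `n`; `ψ_n(0) ≠ 0`).
[cite: ConnesConsaniMoscovici2025, §7 eqs. (7.5), (7.10)–(7.12)] -/
structure IsProlateFunction (lam : ℝ) (n : ℕ) (f : ℝ → ℝ) : Prop where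
  lam_pos : 0 < lam
  contDiffOn : ContDiffOn ℝ 2 f (Set.Icc (-lam) lam)
  eigen : ∃ χ : ℝ, ∀ x ∈ Set.Ioo (-lam) lam,
    -(deriv (fun y ↦ (lam ^ 2 - y ^ 2) * deriv f y) x) + (2 * π * lam * x) ^ 2 * f x = χ * f x
  support : ∀ x : ℝ, lam < |x| → f x = 0
  zeros_finite : {x : ℝ | x ∈ Set.Ioo (-lam) lam ∧ f x = 0}.Finite
  zeros_card : {x : ℝ | x ∈ Set.Ioo (-lam) lam ∧ f x = 0}.ncard = n
  norm_one : ∫ x in (-lam)..lam, f x ^ 2 = 1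
  pos_zero : 0 < f 0

/-- Existence and uniqueness of the prolate functions `h_{n,λ}` for even `n` (Slepian–Pollak 1961;
Connes–Consani–Moscovici 2025, §7 (7.9)–(7.12): the principal eigenfunctions of `PW_λ` form an orthonormal
basis of `L²([−λ,λ])`, the `n`-th has exactly `n` zeros in `(−λ,λ)`, is entire, and `ψ_n(0) ≠ 0` for even
`n`).  Stated separately so that the interface `IsProlateFunction` asserts nothing by itself; proved in
the tree: `existsUnique_isProlateFunction_holds` (file `ProlateExistsUnique.lean`).
[cite: ConnesConsaniMoscovici2025, §7 eqs. (7.9)–(7.12)] -/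
def existsUnique_isProlateFunction : Prop :=
  ∀ lam : ℝ, 0 < lam → ∀ n : ℕ, Even n → ∃! f : ℝ → ℝ, IsProlateFunction lam n f

/-- The Letter's `h_λ` (normalisation N1 of the connes-x13 bundle): `h_λ = (√3 / 2^{11/4}) · (h_{4,λ} − (∫h_{4,λ} / ∫h_{0,λ}) · h_{0,λ})`,
the combination of `h_{4,λ}, h_{0,λ}` with vanishing integral whose `h_{4,λ}`-coefficient is that of `h_4` in
`h` (Connes–Consani–Moscovici 2025, (7.4); Connes 2026, Fact 6.2 and (6.6)).  `∫ h_{0,λ} ≠ 0` since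
`h_{0,λ} > 0` on `(−λ, λ)`. [cite: Connes2026Letter, §6.4 eq. (6.6)] -/
def prolateGuessH (lam : ℝ) (f0 f4 : ℝ → ℝ) (x : ℝ) : ℝ :=
  (Real.sqrt 3 / (2 : ℝ) ^ ((11 : ℝ) / 4)) *
    (f4 x - ((∫ y in (-lam)..lam, f4 y) / (∫ y in (-lam)..lam, f0 y)) * f0 x)

/-- The Mellin transform over `[λ^{-1}, λ]` of the prolate guess `k_λ = 𝓔(h_λ)|_{[λ^{-1},λ]}` (Letter (6.6)):
`M_λ(s) = ∫_{1/λ}^{λ} 𝓔(h_λ)(u) u^{s-1} du` (Connes 2026, §6.4–6.5).  In the Letter's Fourier variable,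
`s = −iz`. [cite: Connes2026Letter, §6.4 eq. (6.6)] -/
def prolateGuessMellin (lam : ℝ) (f0 f4 : ℝ → ℝ) (s : ℂ) : ℂ :=
  ∫ u in Set.Icc (1 / lam) lam, (connesE (prolateGuessH lam f0 f4) u : ℂ) * (u : ℂ) ^ (s - 1)

/-- **Fact 6.4 of Connes' Letter = Lemma 7.3 of Connes–Consani–Moscovici (2025)** (the statement;
proved in the tree, see below),
Mellin form with the tree's `ξ`: for every closed substrip `|Re s| ≤ α₀ < 1/2` and every `ε > 0` there is
`Λ` such that for `λ ≥ Λ`, `‖4 · M_λ(s) − ξ(1/2 + s)‖ ≤ ε` on the strip, where `M_λ` is the Mellin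
transform of the prolate guess `k_λ = 𝓔(h_λ)` on `[λ^{-1}, λ]` ("the Fourier transform of `k_λ` converges,
when `λ → ∞`, towards the `Ξ`-function of Riemann uniformly on closed substrips of the open strip
`|Im z| < 1/2`").  Proved in print, unconditionally, with the bound `c λ^{-1/2-α}(1−2α)^{-1}` on `Re s = α`
(CCM25 pp. 33–34, via Lemma 7.2 = Meixner–Schäfke 1954, §3.2 Satz 9), and proved in the tree,
unconditionally and RH-free: `prolateGuess_tendsto_riemannXi_rhFree` (file `ConnesProlateGuessRHFree.lean`),
with the printed rate as `prolateGuess_rate` (file `ConnesProlateGuessRate.lean`) and the rate `O(λ^{-2})`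
on closed substrips as `prolateGuess_rate_sharp` (file `ConnesProlateGuessRateSharp.lean`); users who take
`(h : prolateGuess_tendsto_riemannXi)` discharge it with `prolateGuess_tendsto_riemannXi_rhFree`.
Numerically tested at `λ² ≤ 20` (and `≤ 50`) on `|Im s| ≤ 60`: observed error `≈ 0.12 · λ^{-2}`
(connes-x13 bundle, `RATE.md`); the `λ^{-2}` law with explicit constants for `λ² ≥ 13` is proved on paper
in that bundle (module docstring); those explicit constants are not formalised.
[cite: ConnesConsaniMoscovici2025, Lemma 7.3] -/
def prolateGuess_tendsto_riemannXi : Prop :=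
  ∀ α₀ : ℝ, 0 ≤ α₀ → α₀ < 1 / 2 → ∀ ε : ℝ, 0 < ε →
    ∃ Λ : ℝ, ∀ lam : ℝ, Λ ≤ lam → ∀ f0 f4 : ℝ → ℝ,
      IsProlateFunction lam 0 f0 → IsProlateFunction lam 4 f4 →
        ∀ s : ℂ, |s.re| ≤ α₀ →
          ‖4 * prolateGuessMellin lam f0 f4 s - riemannXi (1 / 2 + s)‖ ≤ ε

/-- Sanity lemma: `h_λ` has vanishing integral over `[−λ, λ]` whenever `∫ h_{0,λ} ≠ 0` — the defining
property of `h_λ` in the Letter (Connes 2026, (6.6)). [cite: Connes2026Letter, §6.4 eq. (6.6)] -/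
theorem integral_prolateGuessH_eq_zero (lam : ℝ) (f0 f4 : ℝ → ℝ)
    (h0 : IntervalIntegrable f0 volume (-lam) lam) (h4 : IntervalIntegrable f4 volume (-lam) lam)
    (hI : (∫ y in (-lam)..lam, f0 y) ≠ 0) :
    ∫ x in (-lam)..lam, prolateGuessH lam f0 f4 x = 0 := by
  unfold prolateGuessH
  rw [intervalIntegral.integral_const_mul, intervalIntegral.integral_sub h4 (h0.const_mul _),
    intervalIntegral.integral_const_mul, div_mul_cancel₀ _ hI, sub_self, mul_zero]

end Literature.NumberTheory.LFunctions
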